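/-
Copyright (c) 2026 the pub-hodgecm-mathlib formalisation cell (harness21).  Prover seat hodgecm-mathlib-K2E4-p23 (g2), Track B ∕ K2-LIT, h413 =
`stmt-HodgeConjecture-24833`, ENGINE E1, 5Res campaign «ENDGAME BY FAMILIES», ROADCARD §3′ (M2 v2), deal (209) of K2E1-plan (g7): D5′-pre — the residual part of the
discrete part is the closed span of the irreducibles orthogonal to the cusp forms (first line of §3′.1; T9′'s `hdisc` payer).
-/
import Summits.HodgeConjecture.HodgeConjecture.Theorems.K2E1CuspidalSpectrumUnitaryDefs   -- ★ `residualPart`, `residualSubspace`, `cmResidualSubspace`, `cmCuspidalSubspace`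
import Literature.NumberTheory.Automorphic.HilbertRepSpectrumProofs                       -- ★ `IsTopIrreducible.exists_norm_map_eq_mul`, `ClosedSubrep.ofLinearIsometry`, `isTopIrreducible_congr`, `IsUnitary.toContRep`
import Literature.NumberTheory.Automorphic.DiscreteSummandProjection                     -- ★ `ClosedSubrep.starProjection_map_apply` (P_W commutes with π)
import HarnessLib

/-!
# K2·E1 — `K2E1ResidualPartSpanIrreduciblesU`: `L²_disc ⊓ (L²_cusp)ᗮ` IS THE CLOSED SPAN OF THE IRREDUCIBLE CLOSED SUBREPRESENTATIONS ORTHOGONAL TO `L²_cusp`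
# (ROADCARD §3′ D5′-pre: the first line of the spectral-measure exhaustion; generic unitary representations, then the `U(Φ_N)` print)

Track B ∕ K2-LIT, crux h413 = `stmt-HodgeConjecture-24833`, route of record `HCCMUnconditional`; cell `hodgecm-mathlib`, squad K2, ENGINE E1 (5Res campaign, M2 v2).  Prover seat
`hodgecm-mathlib-K2E4-p23` (g2); deal (209).  THEOREMS ONLY (no `def`, no `instance`, no notation, no named-fact hypothesis, no `sorry`); lane
`--supports stmt-HodgeConjecture-24833 --as helper` (count-neutral).  CLOSES NO SOCKET.

THE STATEMENT.  `π` a UNITARY representation on a Hilbert space `H`, `C` a closed invariant subspace (E1: `L²_cusp`), `D := π.discretePart = closure Σ {W irreducible}` (★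
`HilbertRepSpectrum`), `residualPart hπ D C = D ⊓ Cᗮ` (★ `K2E1CuspidalSpectrumUnitaryDefs`).  THEN
**`residualPart hπ π.discretePart C = iSupClosure {W | W.toContRep.IsTopIrreducible ∧ W ≤ C.orthogonal hπ}`** (`residualPart_discretePart_eq`; `≤` is the content, `≥` is formal).
PROOF of `≤`.  `P := P_{Cᗮ}` commutes with `π` (both `C` and `Cᗮ` invariant, `π` unitary).  For `W` irreducible: either `W ≤ C` (then `P(W) = 0`) or the compression `T = P|_W : W → Cᗮ` is a
non-zero intertwiner out of an irreducible, so `‖T v‖ = r‖v‖`, `r > 0` (★ `IsTopIrreducible.exists_norm_map_eq_mul` — Schur), `U := r⁻¹T` is an isometric intertwiner, its image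
`W'' = P(W)` is a closed invariant subspace of `Cᗮ` (★ `ClosedSubrep.ofLinearIsometry`) unitarily equivalent to `W`, hence IRREDUCIBLE (★ `isTopIrreducible_congr`); so `P(W) ⊆ Σ`
(§1 — the ★ compression argument `ClosedSubrep.exists_le_orthogonal_areUnitarilyEquivalent` re-run with the clause «`P v ∈ W''`» its statement forgets).  `{x | P x ∈ closure Σ}` is a
closed submodule containing every irreducible `W`, hence `D`; and `v ∈ D ⊓ Cᗮ` has `v = P v` (§2).
PRINTS (§3): `residualSubspace 𝒢 μ 𝔓` for every adelic datum, and **`cmResidualSubspace_eq_iSupClosure`** for `U(Φ_N)` — «`L²_res` is the closed span of the irreducible closed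
subrepresentations of `R` orthogonal to `L²_cusp`» (T9′'s `hdisc` letter; §3′.1 line 1).
HONEST LABEL: HC_CM is proved only modulo the 7 printed citations (2 remaining named inputs: hLiu418 = `stmt-HodgeConjecture-24832`, h413 = `stmt-HodgeConjecture-24833`) until rung 0
closes; this file asserts no named fact and closes no socket; count-neutral.

## References
* [DeitmarEchterhoff2014] A. Deitmar, S. Echterhoff, *Principles of Harmonic Analysis* (2nd ed., 2014), Lemma 6.1.7, Cor. 6.1.9 (Schur; intertwiners out of irreducibles).
* [Dixmier1977] J. Dixmier, *C*-algebras* (1977), §5.4, §13.1 (discrete part, closed subrepresentations).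
* [MoeglinWaldspurger1995] C. Mœglin, J.-L. Waldspurger, *Spectral decomposition and Eisenstein series* (1995), I.2.18, V.3.13 (`L²_res = L²_disc ⊖ L²_cusp`).
-/

set_option autoImplicit false
-- the mandated namespace repeats the single-problem summit's segment (`HodgeConjecture.HodgeConjecture`)
set_option linter.dupNamespace false

noncomputable section

open ContRepresentation MeasureTheory NumberField
open scoped InnerProductSpace
open Summit.HodgeConjecture.HodgeConjecture.Cruxes.H413.K2E1CuspidalSpectrumUnitary

namespace Summit.HodgeConjecture.HodgeConjecture.Cruxes.H413.K2E1ResidualPartSpanIrreduciblesU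

section Generic

variable {G H : Type*} [Group G] [NormedAddCommGroup H] [InnerProductSpace ℂ H] [CompleteSpace H] {π : ContRepresentation ℂ G H}

/-! ## §1 The projection of an irreducible onto `Cᗮ` lands in the closed span of the irreducibles below `Cᗮ` -/

/-- **THE COMPRESSION OF AN IRREDUCIBLE ONTO `Cᗮ` LIES IN AN IRREDUCIBLE BELOW `Cᗮ`** (★ `ClosedSubrep.exists_le_orthogonal_areUnitarilyEquivalent`, re-run with the membership clause):
for `W` irreducible and `v ∈ W`, `P_{Cᗮ} v ∈ iSupClosure {W' irreducible, W' ≤ Cᗮ}` — if `W ≤ C` the projection vanishes; otherwise `P|_W = r·U` with `U` an isometric intertwiner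
(Schur, ★ `IsTopIrreducible.exists_norm_map_eq_mul`) and `P v = r·U v` lies in the irreducible image `U(W) ≤ Cᗮ` (★ `ClosedSubrep.ofLinearIsometry`, ★ `isTopIrreducible_congr`).
[cite: DeitmarEchterhoff2014, Cor. 6.1.9] [cite: Dixmier1977, §5.4] -/
theorem starProjection_mem_iSupClosure_irreducible (hπ : π.IsUnitary) (C W : ClosedSubrep π) (hW : W.toContRep.IsTopIrreducible) {v : H} (hv : v ∈ W) :
    (C.orthogonal hπ).toSubmodule.starProjection v ∈
      ClosedSubrep.iSupClosure {W' : ClosedSubrep π | W'.toContRep.IsTopIrreducible ∧ W' ≤ C.orthogonal hπ} := by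
  set L : ClosedSubrep π := C.orthogonal hπ with hL
  by_cases hle : W ≤ C
  · -- `v ∈ C = (Cᗮ)ᗮ`, so the projection onto `Cᗮ` kills it
    have h0 : L.toSubmodule.starProjection v = 0 := by
      have hv' : v ∈ L.toSubmoduleᗮ := by
        rw [hL, ClosedSubrep.toSubmodule_orthogonal, Submodule.orthogonal_orthogonal]
        exact hle hv
      rw [Submodule.starProjection_apply, Submodule.orthogonalProjectionOnto_eq_zero_iff.2 hv', Submodule.coe_zero]
    rw [h0]
    exact Submodule.zero_mem _
  · -- the compression `T = P_{Cᗮ}|_W`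
    set T : W.toSubmodule →L[ℂ] L.toSubmodule := L.toSubmodule.orthogonalProjectionOnto ∘L W.toSubmodule.subtypeL with hTdef
    have hTapply : ∀ w : W.toSubmodule, (T w : H) = L.toSubmodule.starProjection w := fun w => rfl
    have hT : ∀ g : G, T ∘L W.toContRep g = L.toContRep g ∘L T := by
      intro g
      apply ContinuousLinearMap.ext
      intro w
      apply Subtype.ext
      change L.toSubmodule.starProjection (π g w) = π g (L.toSubmodule.starProjection w)
      exact ClosedSubrep.starProjection_map_apply hπ L g w
    -- `T ≠ 0` because `W` is not contained in `C = Cᗮᗮ`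
    have hT0 : ∃ w : W.toSubmodule, T w ≠ 0 := by
      by_contra h0
      push Not at h0
      apply hle
      intro w hw
      have h1 : (w : H) ∈ L.toSubmoduleᗮ := Submodule.orthogonalProjectionOnto_eq_zero_iff.mp (h0 ⟨w, hw⟩)
      rw [hL, ClosedSubrep.toSubmodule_orthogonal, Submodule.orthogonal_orthogonal] at h1
      exact h1
    obtain ⟨r, hr0, hr⟩ := hW.exists_norm_map_eq_mul (hπ.toContRep W) (hπ.toContRep L) hT
    have hrpos : 0 < r := by
      obtain ⟨w, hw⟩ := hT0
      rcases hr0.lt_or_eq with h | h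
      · exact h
      · exact absurd (by rw [← norm_eq_zero, hr w, ← h, zero_mul]) hw
    -- the isometric intertwiner `U = r⁻¹ T : W → H`
    let U : W.toSubmodule →ₗᵢ[ℂ] H :=
      { toLinearMap := ((r⁻¹ : ℝ) : ℂ) • ((L.toSubmodule.subtypeL ∘L T : W.toSubmodule →L[ℂ] H) : W.toSubmodule →ₗ[ℂ] H)
        norm_map' := fun w => by
          change ‖((r⁻¹ : ℝ) : ℂ) • (T w : H)‖ = ‖w‖
          rw [norm_smul, Complex.norm_real, Real.norm_eq_abs, abs_of_nonneg (inv_nonneg.mpr hr0), Submodule.norm_coe, hr w, ← mul_assoc,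
            inv_mul_cancel₀ hrpos.ne', one_mul] }
    have hUapply : ∀ w : W.toSubmodule, U w = ((r⁻¹ : ℝ) : ℂ) • (T w : H) := fun w => rfl
    have hU : ∀ (g : G) (w : W.toSubmodule), U (W.toContRep g w) = π g (U w) := by
      intro g w
      have h := congrArg (fun f : W.toSubmodule →L[ℂ] L.toSubmodule => (f w : H)) (hT g)
      simp only [ContinuousLinearMap.coe_comp, Function.comp_apply] at h
      rw [hUapply, hUapply, h, map_smul]
      rfl
    -- its image `W'' = P(W)`: closed, invariant, below `Cᗮ`, irreducible
    have hW''le : ClosedSubrep.ofLinearIsometry U hU ≤ L := by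
      rintro x ⟨w, rfl⟩
      change U w ∈ L
      rw [hUapply]
      exact L.toSubmodule.smul_mem _ (T w).2
    have hW''irr : (ClosedSubrep.ofLinearIsometry U hU).toContRep.IsTopIrreducible :=
      (isTopIrreducible_congr (ClosedSubrep.equivOfLinearIsometry U hU)).1 hW
    -- `P v = r • U v ∈ W''`
    have hPv : L.toSubmodule.starProjection v = (r : ℂ) • U ⟨v, hv⟩ := by
      rw [hUapply, smul_smul, ← Complex.ofReal_mul, mul_inv_cancel₀ hrpos.ne', Complex.ofReal_one, one_smul]
      rfl
    rw [hPv]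
    exact ClosedSubrep.le_iSupClosure (S := {W' : ClosedSubrep π | W'.toContRep.IsTopIrreducible ∧ W' ≤ C.orthogonal hπ}) ⟨hW''irr, hW''le⟩
      ((ClosedSubrep.ofLinearIsometry U hU).toSubmodule.smul_mem _ ⟨⟨v, hv⟩, rfl⟩)

/-! ## §2 `D ⊓ Cᗮ` is the closed span of the irreducibles below `Cᗮ` -/

/-- **`≤`: THE RESIDUAL PART OF THE DISCRETE PART IS SPANNED BY THE IRREDUCIBLES ORTHOGONAL TO `C`** — `residualPart hπ π.discretePart C ≤ iSupClosure {W irreducible, W ≤ Cᗮ}`: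
`{x | P_{Cᗮ} x ∈ RHS}` is a closed submodule containing every irreducible `W` (§1), hence `D`; and `v ∈ D ⊓ Cᗮ` equals `P_{Cᗮ} v`. [cite: Dixmier1977, §5.4] [cite: MoeglinWaldspurger1995, I.2.18] -/
theorem residualPart_discretePart_le (hπ : π.IsUnitary) (C : ClosedSubrep π) :
    residualPart hπ π.discretePart C ≤ ClosedSubrep.iSupClosure {W' : ClosedSubrep π | W'.toContRep.IsTopIrreducible ∧ W' ≤ C.orthogonal hπ} := by
  intro v hv
  obtain ⟨hvD, hvC⟩ := (mem_residualPart_iff hπ π.discretePart C).1 hv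
  set L : ClosedSubrep π := C.orthogonal hπ with hL
  set R : ClosedSubrep π := ClosedSubrep.iSupClosure {W' : ClosedSubrep π | W'.toContRep.IsTopIrreducible ∧ W' ≤ C.orthogonal hπ} with hR
  have hvL : v ∈ L.toSubmodule := (Submodule.mem_orthogonal _ _).2 hvC
  have hPv : L.toSubmodule.starProjection v = v := Submodule.starProjection_eq_self_iff.2 hvL
  -- the closed submodule `{x | P x ∈ R}` contains every irreducible, hence the discrete part
  set Tm : Submodule ℂ H := R.toSubmodule.comap (L.toSubmodule.starProjection : H →L[ℂ] H).toLinearMap with hTm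
  have hTc : IsClosed (Tm : Set H) := R.isClosed.preimage (L.toSubmodule.starProjection).continuous
  have hsup : (⨆ W ∈ {W : ClosedSubrep π | W.toContRep.IsTopIrreducible}, (W : ClosedSubrep π).toSubmodule) ≤ Tm :=
    iSup₂_le fun W hW x hx => Submodule.mem_comap.2 (starProjection_mem_iSupClosure_irreducible hπ C W hW hx)
  have hD : π.discretePart.toSubmodule ≤ Tm := Submodule.topologicalClosure_minimal _ hsup hTc
  have h := hD hvD
  rw [hTm, Submodule.mem_comap] at h
  change L.toSubmodule.starProjection v ∈ R at h
  rwa [hPv] at h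

/-- **`≥` (formal)**: every irreducible `W ≤ Cᗮ` lies in `D` (★ `le_discretePart`) and in `Cᗮ`, and `D ⊓ Cᗮ` is closed. [cite: Dixmier1977, §5.4] -/
theorem iSupClosure_irreducible_le_residualPart (hπ : π.IsUnitary) (C : ClosedSubrep π) :
    ClosedSubrep.iSupClosure {W' : ClosedSubrep π | W'.toContRep.IsTopIrreducible ∧ W' ≤ C.orthogonal hπ} ≤ residualPart hπ π.discretePart C := by
  intro v hv
  have hle : (⨆ W ∈ {W' : ClosedSubrep π | W'.toContRep.IsTopIrreducible ∧ W' ≤ C.orthogonal hπ}, (W : ClosedSubrep π).toSubmodule) ≤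
      (residualPart hπ π.discretePart C).toSubmodule :=
    iSup₂_le fun W hW x hx => ⟨le_discretePart hW.1 hx, hW.2 hx⟩
  exact (Submodule.topologicalClosure_minimal _ hle (residualPart hπ π.discretePart C).isClosed) hv

/-- **`D ⊓ Cᗮ = closure Σ {W irreducible, W ≤ Cᗮ}`** for every unitary representation and every closed invariant `C`. [cite: Dixmier1977, §5.4] [cite: MoeglinWaldspurger1995, I.2.18] -/
theorem residualPart_discretePart_eq (hπ : π.IsUnitary) (C : ClosedSubrep π) :
    residualPart hπ π.discretePart C = ClosedSubrep.iSupClosure {W' : ClosedSubrep π | W'.toContRep.IsTopIrreducible ∧ W' ≤ C.orthogonal hπ} :=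
  le_antisymm (residualPart_discretePart_le hπ C) (iSupClosure_irreducible_le_residualPart hπ C)

end Generic

/-! ## §3 Prints: `L²_res` of an adelic group datum, and of `U(Φ_N)` -/

section Prints

universe u

variable {K : Type} [Field K] [NumberField K]

/-- **`L²_res = closure Σ {irreducible W ≤ (L²_cusp)ᗮ}`** for every adelic group datum and every automorphic measure (the residual spectrum ★ `residualSubspace` is, by definition,
`L²_disc ⊓ (L²_cusp)ᗮ` with `L²_disc = discretePart R`). [cite: MoeglinWaldspurger1995, I.2.18 and V.3.13] -/
theorem residualSubspace_eq_iSupClosure (𝒢 : Literature.NumberTheory.Automorphic.AdelicGroupData.{u} K) (μ : Measure 𝒢.automorphicQuotient) [𝒢.IsAutomorphicMeasure μ]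
    (𝔓 : 𝒢.ParabolicUnipotentData) :
    residualSubspace 𝒢 μ 𝔓 = ClosedSubrep.iSupClosure {W : ClosedSubrep (𝒢.rightRegular μ) |
      W.toContRep.IsTopIrreducible ∧ W ≤ (𝒢.cuspidalSubspace μ 𝔓).orthogonal (𝒢.isUnitary_rightRegular μ)} :=
  residualPart_discretePart_eq _ _

/-- **`L²_res(U(Φ_N))` IS THE CLOSED SPAN OF THE IRREDUCIBLE CLOSED SUBREPRESENTATIONS OF `R` ORTHOGONAL TO `L²_cusp(U(Φ_N))`** — ROADCARD §3′.1 line 1 ∕ T9′'s `hdisc` letter.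
[cite: MoeglinWaldspurger1995, I.2.18 and V.3.13] [cite: Dixmier1977, §5.4] -/
theorem cmResidualSubspace_eq_iSupClosure (L : Type) [Field L] [NumberField L] [IsCMField L] (N : ℕ)
    (μ : Measure (Literature.NumberTheory.Automorphic.UnitaryGroup.cmDatum L N (Matrix.of fun i j : Fin N => if i.val + j.val + 1 = N then (1 : L) else 0)).automorphicQuotient)
    [(Literature.NumberTheory.Automorphic.UnitaryGroup.cmDatum L N (Matrix.of fun i j : Fin N => if i.val + j.val + 1 = N then (1 : L) else 0)).IsAutomorphicMeasure μ] :
    cmResidualSubspace L N μ = ClosedSubrep.iSupClosure {W : ClosedSubrep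
        ((Literature.NumberTheory.Automorphic.UnitaryGroup.cmDatum L N (Matrix.of fun i j : Fin N => if i.val + j.val + 1 = N then (1 : L) else 0)).rightRegular μ) |
      W.toContRep.IsTopIrreducible ∧ W ≤ (cmCuspidalSubspace L N μ).orthogonal
        ((Literature.NumberTheory.Automorphic.UnitaryGroup.cmDatum L N (Matrix.of fun i j : Fin N => if i.val + j.val + 1 = N then (1 : L) else 0)).isUnitary_rightRegular μ)} :=
  residualSubspace_eq_iSupClosure _ μ _

end Prints

end Summit.HodgeConjecture.HodgeConjecture.Cruxes.H413.K2E1ResidualPartSpanIrreduciblesU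

end
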